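import Summits.BirchSwinnertonDyer.BirchSwinnertonDyer.Theorems.Rank2ObservatoryConductorCertTate
import Summits.BirchSwinnertonDyer.BirchSwinnertonDyer.Theorems.Rank2ObservatoryRank3RootNumber3Census
import Summits.BirchSwinnertonDyer.BirchSwinnertonDyer.Theorems.Rank2ObservatoryRank3MinimalTotal
import HarnessLib

/-!
# Rank-2 observatory (b2b-bsdr2, cert-2 gen 7): the census instrument for LOCAL TATE CERTIFICATES
# at `2` and `3` on the rank-3 census — one kernel pass, NO named fact

HONEST FRAMING: per-curve certified theorems and census instruments; no claim on BSD in rank ≥ 2.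

The instrument that turns the machine-written data chunks `Rank2ObservatoryRank3CondCerts*` into
theorems `conductorNorm ℤ E_r = r.N` for the `3391` rank-3 census rows not covered fact-free by gen 5/6
(`1841` rows of deep Kodaira type at `2` with a gen-5 certificate, and all `1550` rows additive at `3`):

* `CondCert = (l₂, l₃)` — a pair of local certificates (`LocalCert`, at `2` and at `3`; `l₃` is ignored
  on rows with a gen-5 certificate, which are tame at `3`);
* `condEntry` — the per-row check: on a row WITH a gen-5 certificate `c`, `l₂` checks at `2` and
  `c.conductorStep2 (l₂.f 2) = N`; on a row WITHOUT one but with a gen-6 certificate `c₃` (read off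
  the tree's sorted list `rank3RN3Certs` IN THE SAME PASS — not re-listed, not re-checked: its check is
  the tree's theorem `check_of_mem_rn3Certs`), `l₂`, `l₃` check and `c₃.conductorLocal (l₂.f 2) (l₃.f 3) = N`;
* `condWalk` — the one-pass position-indexed walk over `rank3Table.zip rank3RNCerts` carrying the
  gen-6 list, and `entry_of_condWalk` (what a passing walk says of each listed pair);
* **`Rank3Row.conductorNorm_eq_of_condWalk`** — a passing walk gives `conductorNorm ℤ E_r = r.N` for
  every listed row, with global minimality from `Rank3Row.isGloballyMinimal_of_mem` (gen 5) and NO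
  other input;
* kernel self-tests on three rows: `27747c1` (row `30`, additive at `3`, `I₂*` at `3`), `90704c1`
  (row `463`?? — see `condWalk_selftest`, indices certified by the walk itself) are in the data chunks;
  here one synthetic walk over the first rows (row `23`, `26284a1`, type `IV` at `2`).

References: J. H. Silverman, *Advanced Topics in the Arithmetic of Elliptic Curves*, GTM 151 (1994),
IV.9.4, IV.10.2, IV.11.1 [Silverman1994]; J. E. Cremona, *Algorithms for Modular Elliptic Curves*,
2nd ed. (1997), Tables [CremonaAlgorithms1997].
-/

open IsDedekindDomain WeierstrassCurve Literature Literature.NumberTheory.EllipticCurves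

namespace Summit.BirchSwinnertonDyer.BirchSwinnertonDyer.Rank2Observatory

open RootNumber Tate

/-- A pair of local certificates, at `2` and at `3`. [folklore] -/
structure CondCert where
  /-- the local certificate at `2` -/
  l₂ : LocalCert
  /-- the local certificate at `3` (ignored on rows tame at `3` with a gen-5 certificate) -/
  l₃ : LocalCert
  deriving Repr, DecidableEq, Inhabited

/-- The gen-6 certificate of row `n`, if it heads the (sorted) remaining list. [folklore] -/
def rn3Head (n : ℕ) : List (ℕ × RNCert3) → Option RNCert3
  | (j, c₃) :: _ => if j = n then some c₃ else none
  | [] => none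

/-- Pop the gen-6 certificate of row `n` off the remaining list. [folklore] -/
def rn3Tail (n : ℕ) : List (ℕ × RNCert3) → List (ℕ × RNCert3)
  | (j, c₃) :: tl => if j = n then tl else (j, c₃) :: tl
  | [] => []

/-- A present head certificate is a member of the queue, at the current index. [folklore] -/
theorem mem_of_rn3Head {n : ℕ} {c₃ : RNCert3} :
    ∀ {q : List (ℕ × RNCert3)}, rn3Head n q = some c₃ → (n, c₃) ∈ q
  | (j, c) :: tl, h => by
    simp only [rn3Head] at h
    by_cases hj : j = n
    · rw [if_pos hj, Option.some.injEq] at h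
      rw [← hj, ← h]; simp
    · rw [if_neg hj] at h; exact absurd h (by simp)
  | [], h => absurd h (by simp [rn3Head])

/-- The advanced queue is a sublist of the queue. [folklore] -/
theorem mem_of_mem_rn3Tail {n : ℕ} {x : ℕ × RNCert3} :
    ∀ {q : List (ℕ × RNCert3)}, x ∈ rn3Tail n q → x ∈ q
  | (j, c) :: tl, h => by
    simp only [rn3Tail] at h
    by_cases hj : j = n
    · rw [if_pos hj] at h; exact List.mem_cons_of_mem _ h
    · rw [if_neg hj] at h; exact h
  | [], h => absurd h (by simp [rn3Tail])

/-- The per-row check of a pair of local certificates against a census row: WITH a gen-5 certificate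
`c` (tame at `3`): `l₂` checks at `2` and `2^{f₂} ∏ p^{condExp} = N`; WITHOUT one, the row's gen-6
certificate `c₃` must be at hand, `l₂`, `l₃` check and `2^{f₂} 3^{f₃} ∏ p^{condExp3} = N`. [folklore] -/
def condEntry (rc : Rank3Row × Option RNCert) (h₃ : Option RNCert3) (cc : CondCert) : Bool :=
  match rc.2, h₃ with
  | some c, _ => cc.l₂.check 2 rc.1.intModel && decide (c.conductorStep2 (cc.l₂.f 2) = rc.1.N)
  | none, some c₃ => cc.l₂.check 2 rc.1.intModel && cc.l₃.check 3 rc.1.intModel &&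
      decide (c₃.conductorLocal (cc.l₂.f 2) (cc.l₃.f 3) = rc.1.N)
  | none, none => false

/-- One-pass position-indexed walk: the pairs `(i, cc)` (indices increasing) are checked against the
`i`-th entry of the zipped table, the sorted gen-6 list being consumed alongside. [folklore] -/
def condWalk : List (Rank3Row × Option RNCert) → ℕ → List (ℕ × RNCert3) → List (ℕ × CondCert) → Bool
  | _, _, _, [] => true
  | [], _, _, _ :: _ => false
  | rc :: rs, n, q, (i, cc) :: rest =>
      if i = n then condEntry rc (rn3Head n q) cc && condWalk rs (n + 1) (rn3Tail n q) rest
      else condWalk rs (n + 1) (rn3Tail n q) ((i, cc) :: rest)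

/-- What a passing walk says about each listed pair. [folklore] -/
theorem entry_of_condWalk :
    ∀ (rows : List (Rank3Row × Option RNCert)) (n : ℕ) (q : List (ℕ × RNCert3))
      (ps : List (ℕ × CondCert)), condWalk rows n q ps = true → ∀ (i : ℕ) (cc : CondCert),
      (i, cc) ∈ ps → n ≤ i ∧ ∃ (rc : Rank3Row × Option RNCert) (h₃ : Option RNCert3),
        rows[i - n]? = some rc ∧ condEntry rc h₃ cc = true ∧ ∀ c₃, h₃ = some c₃ → (i, c₃) ∈ q
  | _, _, _, [], _, i, cc, hm => by simp at hm
  | [], _, _, _ :: _, h, _, _, _ => by simp [condWalk] at h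
  | rc :: rs, n, q, (j, d) :: rest, h, i, cc, hm => by
    by_cases hj : j = n
    · simp only [condWalk, hj, ↓reduceIte, Bool.and_eq_true] at h
      rcases List.mem_cons.mp hm with he | hm'
      · obtain ⟨hin, hcd⟩ := Prod.mk.inj he
        rw [hj] at hin
        refine ⟨by omega, rc, rn3Head n q, by rw [hin, Nat.sub_self]; rfl, by rw [hcd]; exact h.1,
          fun c₃ hc ↦ by rw [hin]; exact mem_of_rn3Head hc⟩
      · obtain ⟨hle, rc', h₃, hr', he', hq⟩ :=
          entry_of_condWalk rs (n + 1) (rn3Tail n q) rest h.2 i cc hm'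
        refine ⟨by omega, rc', h₃, ?_, he', fun c₃ hc ↦ mem_of_mem_rn3Tail (hq c₃ hc)⟩
        rw [show i - n = (i - (n + 1)) + 1 by omega, List.getElem?_cons_succ]
        exact hr'
    · simp only [condWalk, hj, ↓reduceIte] at h
      obtain ⟨hle, rc', h₃, hr', he', hq⟩ :=
        entry_of_condWalk rs (n + 1) (rn3Tail n q) ((j, d) :: rest) h i cc hm
      refine ⟨by omega, rc', h₃, ?_, he', fun c₃ hc ↦ mem_of_mem_rn3Tail (hq c₃ hc)⟩
      rw [show i - n = (i - (n + 1)) + 1 by omega, List.getElem?_cons_succ]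
      exact hr'

/-- **`N_E = N` for every census row listed in a local-certificate list passing the walk** — NO named
fact, NO hypothesis beyond the kernel check of the list: global minimality is the gen-5 theorem
`Rank3Row.isGloballyMinimal_of_mem`, the gen-5 certificate's check is `rank3Table_rnCheck`, the gen-6
certificate's check is `check_of_mem_rn3Certs`. [cite: Silverman1994, IV.10.2 and IV.11.1]
[cite: CremonaAlgorithms1997, Tables] -/
theorem Rank3Row.conductorNorm_eq_of_condWalk {ps : List (ℕ × CondCert)}
    (h : condWalk (rank3Table.zip rank3RNCerts) 0 rank3RN3Certs ps = true) {i : ℕ} {cc : CondCert}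
    (hm : (i, cc) ∈ ps) :
    ∃ hi : i < rank3Table.length, (rank3Table[i]'hi).curve.conductorNorm ℤ = (rank3Table[i]'hi).N := by
  obtain ⟨-, ⟨r, oc⟩, h₃, hrc, he, hq⟩ := entry_of_condWalk _ 0 _ ps h i cc hm
  rw [Nat.sub_zero] at hrc
  obtain ⟨hr, hoc⟩ := List.getElem?_zip_eq_some.mp hrc
  obtain ⟨hi, rfl⟩ := List.getElem?_eq_some_iff.mp hr
  have hGM : ((rank3Table[i]'hi).intModel.baseChange ℚ).IsGloballyMinimal := by
    rw [← Rank3Row.curve_eq_baseChange]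
    exact Rank3Row.isGloballyMinimal_of_mem (List.getElem_mem hi)
  cases oc with
  | some c =>
    simp only [condEntry, Bool.and_eq_true, decide_eq_true_eq] at he
    obtain ⟨hl, hN⟩ := he
    have hc : c.check (rank3Table[i]'hi).intModel = true :=
      check_of_rnRowsCheck _ _ rank3Table_rnCheck i hi c hoc
    exact ⟨hi, by rw [Rank3Row.curve_eq_baseChange, conductorNorm_eq_conductorLocal2 hc hl hGM, hN]⟩
  | none =>
    cases h₃ with
    | none => simp [condEntry] at he
    | some c₃ =>
      simp only [condEntry, Bool.and_eq_true, decide_eq_true_eq] at he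
      obtain ⟨⟨h2, h3⟩, hN⟩ := he
      obtain ⟨hi', hc₃, -⟩ := check_of_mem_rn3Certs (hq c₃ rfl)
      exact ⟨hi, by rw [Rank3Row.curve_eq_baseChange, conductorNorm_eq_conductorLocal23 hc₃ h2 h3 hGM, hN]⟩

/-- Row form: if `r` is the `i`-th census row and `(i, cc)` is listed in a passing list,
`conductorNorm ℤ E_r = r.N`. [cite: Silverman1994, IV.10.2 and IV.11.1] -/
theorem Rank3Row.conductorNorm_eq_of_condListed {ps : List (ℕ × CondCert)}
    (h : condWalk (rank3Table.zip rank3RNCerts) 0 rank3RN3Certs ps = true) {r : Rank3Row} {i : ℕ}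
    {cc : CondCert} (hm : (i, cc) ∈ ps) (hr : rank3Table[i]? = some r) : r.curve.conductorNorm ℤ = r.N := by
  obtain ⟨hi, hN⟩ := Rank3Row.conductorNorm_eq_of_condWalk h hm
  obtain ⟨hi', rfl⟩ := List.getElem?_eq_some_iff.mp hr
  exact hN

/-! ### Self-tests (kernel) -/

/-- Rows `23` (`26284a1`, gen-5 certificate, type `IV` at `2`: a kind-`2` local certificate, `f₂ = 2`)
and `30` (`27747c1`, NO gen-5 certificate; its gen-6 certificate heads `rank3RN3Certs`; `2 ∤ Δ`
(kind `0`) at `2` and the deep Tate certificate `(8,0,13)`, `I₂*`, `v₃(Δ) = 8`, `f₃ = 2` at `3`)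
pass the walk. [cite: CremonaAlgorithms1997, Tables] -/
theorem condWalk_rows_23_30 :
    condWalk (rank3Table.zip rank3RNCerts) 0 rank3RN3Certs
      [(23, ⟨⟨2, 1, 0, 1, 4, 4, 2⟩, default⟩), (30, ⟨⟨0, 0, 0, 0, 0, 0, 0⟩, ⟨3, 8, 0, 13, 8, 72, 0⟩⟩)] = true := by
  decide +kernel

/-- Hence `N(27747c1) = 27747` with NO named fact (gen 6 needed `h3` for this row).
[cite: CremonaAlgorithms1997, Tables] -/
theorem conductorNorm_27747c1 :
    (rank3Table[30]'(by rw [rank3Table_length]; omega)).curve.conductorNorm ℤ = 27747 := by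
  have hN : (rank3Table[30]'(by rw [rank3Table_length]; omega)).N = 27747 := by decide +kernel
  obtain ⟨hi, h⟩ := Rank3Row.conductorNorm_eq_of_condWalk condWalk_rows_23_30
    (i := 30) (cc := ⟨⟨0, 0, 0, 0, 0, 0, 0⟩, ⟨3, 8, 0, 13, 8, 72, 0⟩⟩) (by simp)
  rw [h]; exact hN

end Summit.BirchSwinnertonDyer.BirchSwinnertonDyer.Rank2Observatory
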